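import Literature.Computability.MetaComplexity.RazborovSmolenskyApprox
import Literature.Computability.MetaComplexity.SmolenskyModq
import Literature.Computability.MetaComplexity.SmolenskyMajority
import HarnessLib

/-!
# Smolensky's correlation bounds: PARITY, MAJORITY and `Σ xᵢ mod q` versus low-degree
# polynomials and `AC⁰[p]` circuits (average-case form)

The AVERAGE-CASE (correlation) form of the Razborov–Smolensky lower bounds, in the vocabulary of
`SmolenskyProperty.lean` / `SmolenskyDimensionBound.lean` / `SmolenskyCharacter.lean`
(`CubeFn F n` = functions `{0,1}ⁿ → F`, `lowDeg F n D` = multilinear polynomials of degree `≤ D`)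
and of `RazborovSmolenskyApprox.lean` (`razborov_smolensky`: a circuit over
`accBasis p = {¬, ∧ₖ, ∨ₖ, MOD_{p,k}}` agrees with a polynomial of degree `((p-1)ℓ)^{depth}` over
`𝔽_p` outside a set `E` with `|E|·p^ℓ ≤ size·2ⁿ`). Everything here is proved; `n` is odd
throughout (as in the worst-case files of this directory).

Polynomial level (Smolensky 1987, proof of Thms. 1–2; Grewal–Kumar 2024, Prop. 4.1
"`Pr_x[p(x) = F(x)] ≤ 1/2 + O(t/√n)` for `F ∈ {MAJ, MOD_r}` and degree-`t` polynomials over `𝔽_q`"):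

* `card_filter_omMono_eq_le` — over any field, for `ω ≠ 0, 1`: a polynomial function of degree
  `≤ D` agrees with the character `x ↦ ω^{Σ xᵢ}` on at most `2ⁿ⁻¹ + D·C(n, n/2)` points of the cube
  (the dimension count `two_pow_le_of_character_approx` with a single piece);
* `modq_agreement_le` — hence, for `ω^q = 1 ≠ ω`: if `x ↦ ω^{g(x)}` agrees off `E` with a
  polynomial function of degree `≤ D`, then `g(x) ≡ Σ xᵢ (mod q)` holds on at most
  `2ⁿ⁻¹ + D·C(n, n/2) + |E|` points;
* `parity_agreement_le` — over a field with `2 ≠ 0`: a polynomial function of degree `≤ D` agrees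
  with the `0/1` indicator of PARITY on at most `2ⁿ⁻¹ + D·C(n, n/2)` points
  (`finrank_space_le_of_bool_approx` + `map_mulLeft_parity_sup_eq_top`);
* `majority_agreement_le` — over ANY field (characteristic `2` included): the same for MAJORITY
  (`finrank_ispace_le` + `ispace_majorityFn_eq_top`).

Circuit level (Grewal–Kumar 2024, Thm. 4.2 "Correlation bounds", the case `k = 1` = `AC⁰[q]`;
Watts–Kothari–Schaeffer–Tal 2019, §6 uses exactly these as the classical half of the
`QNC⁰/qpoly ⊄ AC⁰[p]` separations):

* `razborov_smolensky_multi` — SIMULTANEOUS approximation of `m` circuits `C_j` (depth `≤ d`) over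
  `accBasis p` by polynomials `P_j` of degree `((p-1)ℓ)^d` outside ONE exceptional set `E` with
  `|E|·p^ℓ ≤ (Σ_j size C_j)·2ⁿ` (union bound; the multi-output form used for relation problems);
* `razborov_smolensky_postprocess` — consequently ANY function `Φ(C_1(x), …, C_m(x))` of the `m`
  output wires, with values in a field `F ⊇ 𝔽_p`, agrees off `E` with a polynomial function of
  degree `≤ m·((p-1)ℓ)^d` (multilinear extension of `Φ`);
* `parity_correlation_bound` — `p` an odd prime: a circuit over `accBasis p` of `acDepth ≤ d`
  agrees with PARITY on a set `A` with `|A|·p^ℓ ≤ (2ⁿ⁻¹ + ((p-1)ℓ)^d·C(n,n/2))·p^ℓ + size·2ⁿ`,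
  every `ℓ ≥ 1`;
* `majority_correlation_bound` — the same for MAJORITY and every prime `p`;
* `modq_correlation_bound` — `q` a prime `≠ p`, `m` circuits and an arbitrary decoder
  `dec : {0,1}^m → ℕ` of the output wires into a residue: `dec(C(x)) ≡ Σ xᵢ (mod q)` holds on a set
  `A` with `|A|·p^ℓ ≤ (2ⁿ⁻¹ + m·((p-1)ℓ)^d·C(n,n/2))·p^ℓ + (Σ_j size C_j)·2ⁿ`.

With `C(n, n/2)² · n ≤ 4ⁿ` (`choose_half_sq_mul_le`) these are the printed `1/2 + O(D/√n) + s/p^ℓ`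
bounds. Deliberately NOT here: even `n` (reduce to `n - 1` by fixing a variable), random advice
(`/rpoly`, by averaging), the `GC⁰(k)` gates of Grewal–Kumar, and the `r`-fold parallel versions
(XOR lemma) of Watts–Kothari–Schaeffer–Tal §6 / Grewal–Kumar §5.

## References

* R. Smolensky, *Algebraic methods in the theory of lower bounds for Boolean circuit
  complexity*, Proc. 19th STOC (1987), 77–82, Thms. 1–2 and their proofs [Smolensky1987].
* A. A. Razborov, *Lower bounds on the size of bounded depth circuits over a complete basis with
  logical addition*, Math. Notes 41 (1987), 333–338 [Razborov1987].
* S. Grewal, V. M. Kumar, *Improved circuit lower bounds and quantum-classical separations*,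
  arXiv:2408.16406 (2024), Prop. 4.1, Thm. 4.2 (and §5.3–5.4 for the use in quantum-classical
  separations) [GrewalKumar2024].
* A. Bene Watts, R. Kothari, L. Schaeffer, A. Tal, *Exponential separation between shallow quantum
  circuits and unbounded fan-in shallow classical circuits*, STOC 2019, arXiv:1906.08890, §6
  [WattsEtAl2019].
-/

noncomputable section

namespace Literature.Computability.MetaComplexity

open Finset Module Literature.Computability.Complexity

namespace Smolensky

open scoped Classical

variable {F : Type*} [Field F] {n : ℕ}

/-! ### Counting on the cube -/

/-- `|{x | P x}| + |{x | ¬ P x}| = 2ⁿ` on the cube `{0,1}ⁿ`. [folklore] -/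
private theorem card_filter_add_card_filter_not_cube (P : (Fin n → Bool) → Prop) [DecidablePred P] :
    (univ.filter fun x => P x).card + (univ.filter fun x => ¬ P x).card = 2 ^ n := by
  rw [Finset.card_filter_add_card_filter_not, Finset.card_univ]
  simp

/-! ### Polynomial level: the character `x ↦ ω^{Σ xᵢ}` -/

/-- **Correlation of low-degree polynomials with the character `ω^{Σ xᵢ}`** (Smolensky 1987, proof
of Thms. 1–2, average-case reading; Grewal–Kumar 2024, Prop. 4.1): over any field, for `n` odd and
`ω ≠ 0, 1`, a polynomial function `G` of degree `≤ D` agrees with `x ↦ Π ω^{xᵢ} = ω^{Σ xᵢ}` on at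
most `2ⁿ⁻¹ + D·C(n, n/2)` points of the cube. (The dimension count
`two_pow_le_of_character_approx` with the single piece `Y = 1 · Y`, `P = G`, `E` = the
disagreement set: `2ⁿ ≤ 2ⁿ⁻¹ + D·C(n,n/2) + |E|`.) [cite: Smolensky1987, Thms. 1–2 (proof)] -/
theorem card_filter_omMono_eq_le (hn : Odd n) {ω : F} (hω0 : ω ≠ 0) (hω1 : ω ≠ 1) {D : ℕ}
    {G : CubeFn F n} (hG : G ∈ lowDeg F n D) :
    (univ.filter fun x => omMono ω univ x = G x).card ≤ 2 ^ (n - 1) + D * n.choose (n / 2) := by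
  classical
  have hdim := two_pow_le_of_character_approx hn hω0 hω1 ({()} : Finset Unit)
    (fun _ => (1 : F)) (fun _ => omMono ω univ) (by simp) (D := D) (fun _ => G) (fun _ _ => hG)
    (fun _ => univ.filter fun x => ¬ omMono ω univ x = G x)
    (fun _ _ b hb => by
      by_contra h
      exact hb (Finset.mem_filter.2 ⟨Finset.mem_univ _, h⟩))
  have hchoose := sum_range_choose_le hn D
  have hsplit := card_filter_add_card_filter_not_cube (n := n) (fun x => omMono ω univ x = G x)
  simp only [Finset.sum_singleton] at hdim
  omega

/-- **Correlation of low-degree polynomials with `Σ xᵢ mod q`** (Smolensky 1987, Thm. 2,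
average-case reading; Grewal–Kumar 2024, Prop. 4.1 for `MOD_r`): for `n` odd, `ω^q = 1`, `ω ≠ 1`
(`0 < q`), a function `g : {0,1}ⁿ → ℕ` such that `x ↦ ω^{g(x)}` agrees outside a finite set `E`
with a polynomial function `G` of degree `≤ D`, and the agreement set
`A = {x | g(x) ≡ Σ xᵢ (mod q)}`: `|A| ≤ 2ⁿ⁻¹ + D·C(n, n/2) + |E|` (on `A \ E` the character
`ω^{Σ xᵢ}` equals `ω^{g(x)} = G(x)`). [cite: Smolensky1987, Thm. 2 (proof)] -/
theorem modq_agreement_le (hn : Odd n) {ω : F} {q : ℕ} (hq : 0 < q) (hωq : ω ^ q = 1)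
    (hω1 : ω ≠ 1) {D : ℕ} (g : (Fin n → Bool) → ℕ) {G : CubeFn F n} (hG : G ∈ lowDeg F n D)
    (E : Finset (Fin n → Bool)) (hGg : ∀ x, x ∉ E → G x = ω ^ g x) :
    (univ.filter fun x => g x % q = GateFn.numOnes x % q).card ≤
      2 ^ (n - 1) + D * n.choose (n / 2) + E.card := by
  classical
  have hω0 : ω ≠ 0 := by
    rintro rfl
    rw [zero_pow hq.ne'] at hωq
    exact zero_ne_one hωq
  have hsub : (univ.filter fun x => g x % q = GateFn.numOnes x % q) ⊆
      (univ.filter fun x => omMono ω univ x = G x) ∪ E := by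
    intro x hx
    simp only [Finset.mem_filter, Finset.mem_univ, true_and] at hx
    rw [Finset.mem_union, Finset.mem_filter]
    by_cases hxE : x ∈ E
    · exact Or.inr hxE
    · refine Or.inl ⟨Finset.mem_univ _, ?_⟩
      rw [omMono_univ_apply, hGg x hxE, pow_eq_pow_mod_of_pow_eq_one hωq (GateFn.numOnes x),
        pow_eq_pow_mod_of_pow_eq_one hωq (g x), hx]
  calc (univ.filter fun x => g x % q = GateFn.numOnes x % q).card
      ≤ ((univ.filter fun x => omMono ω univ x = G x) ∪ E).card := Finset.card_le_card hsub
    _ ≤ (univ.filter fun x => omMono ω univ x = G x).card + E.card := Finset.card_union_le _ _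
    _ ≤ 2 ^ (n - 1) + D * n.choose (n / 2) + E.card :=
        Nat.add_le_add_right (card_filter_omMono_eq_le hn hω0 hω1 hG) _

/-! ### Polynomial level: PARITY and MAJORITY -/

/-- **Correlation of low-degree polynomials with PARITY** (Smolensky 1987, Thm. 1, average-case
reading; Razborov 1987; Grewal–Kumar 2024, Prop. 4.1): over a field with `2 ≠ 0`, for `n` odd, a
polynomial function `P` of degree `≤ D` agrees with the `0/1` indicator of PARITY on at most
`2ⁿ⁻¹ + D·C(n, n/2)` points of the cube (`dim(f̄L + L) = 2ⁿ` for parity,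
`map_mulLeft_parity_sup_eq_top`, against `finrank_space_le_of_bool_approx`).
[cite: Smolensky1987, Thm. 1 (proof)] -/
theorem parity_agreement_le (hn : Odd n) (h2 : (2 : F) ≠ 0) {D : ℕ} {P : CubeFn F n}
    (hP : P ∈ lowDeg F n D) :
    (univ.filter fun x => P x = if parityFn n x then 1 else 0).card ≤
      2 ^ (n - 1) + D * n.choose (n / 2) := by
  classical
  have htop : space F (parityFn n) = ⊤ := by
    rw [space, pmOf_parityFn]
    exact map_mulLeft_parity_sup_eq_top hn h2
  have hdim := finrank_space_le_of_bool_approx (F := F) (parityFn n) hP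
    (univ.filter fun x => ¬ P x = if parityFn n x then 1 else 0)
    (fun b hb => by
      by_contra h
      exact hb (Finset.mem_filter.2 ⟨Finset.mem_univ _, fun h' => h h'.symm⟩))
  rw [htop, finrank_top, finrank_cubeFn] at hdim
  have hchoose := sum_range_choose_le hn D
  have hsplit := card_filter_add_card_filter_not_cube (n := n)
    (fun x => P x = if parityFn n x then 1 else 0)
  omega

/-- **Correlation of low-degree polynomials with MAJORITY** (Razborov 1987; Smolensky 1987,
Thm. 1 / §5; Grewal–Kumar 2024, Prop. 4.1 for `MAJ`): over ANY field (characteristic `2`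
included), for `n` odd, a polynomial function `P` of degree `≤ D` agrees with the `0/1` indicator
of MAJORITY on at most `2ⁿ⁻¹ + D·C(n, n/2)` points of the cube (`[MAJ]·L + L = ⊤`,
`ispace_majorityFn_eq_top`, against `finrank_ispace_le`). [cite: Razborov1987, Thm. 1 (method)] -/
theorem majority_agreement_le (hn : Odd n) {D : ℕ} {P : CubeFn F n} (hP : P ∈ lowDeg F n D) :
    (univ.filter fun x => P x = if majorityFn n x then 1 else 0).card ≤
      2 ^ (n - 1) + D * n.choose (n / 2) := by
  classical
  have hdim := finrank_ispace_le (F := F) (majorityFn n) hP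
    (univ.filter fun x => ¬ P x = if majorityFn n x then 1 else 0)
    (fun b hb => by
      by_contra h
      exact hb (Finset.mem_filter.2 ⟨Finset.mem_univ _, fun h' => h h'.symm⟩))
  rw [ispace_majorityFn_eq_top hn, finrank_top, finrank_cubeFn] at hdim
  have hchoose := sum_range_choose_le hn D
  have hsplit := card_filter_add_card_filter_not_cube (n := n)
    (fun x => P x = if majorityFn n x then 1 else 0)
  omega

/-! ### Circuit level: simultaneous approximation of several circuits -/

variable {p : ℕ} [Fact p.Prime]

/-- **Multi-output Razborov–Smolensky approximation.** For a prime `p`, circuits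
`C_1, …, C_m` over `accBasis p` on the same `n` inputs, each of `acDepth ≤ d`, and `ℓ ≥ 1`: there
are polynomial functions `P_j : {0,1}ⁿ → 𝔽_p` of degree `≤ ((p-1)ℓ)^d` and ONE exceptional set
`E` with `|E|·p^ℓ ≤ (Σ_j size C_j)·2ⁿ` such that `P_j(x) = [C_j(x)]` for all `j` and all `x ∉ E`
(`razborov_smolensky` for each `C_j` and the union of the exceptional sets; Smolensky 1987,
Lemma 2 — the union bound over all gates of a multi-output circuit). This is the form used for
relation (search) problems (Watts–Kothari–Schaeffer–Tal 2019, §6; Grewal–Kumar 2024, §5.3–5.4).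
[cite: Smolensky1987, Lemmas 1–2] -/
theorem razborov_smolensky_multi {m : ℕ} (C : Fin m → Circuit (Fin n))
    (hC : ∀ j, (C j).IsOver (accBasis p)) {d : ℕ} (hd : ∀ j, (C j).acDepth ≤ d) {ℓ : ℕ}
    (hℓ : 1 ≤ ℓ) :
    ∃ (P : Fin m → CubeFn (ZMod p) n) (E : Finset (Fin n → Bool)),
      (∀ j, P j ∈ lowDeg (ZMod p) n (((p - 1) * ℓ) ^ d)) ∧
        E.card * p ^ ℓ ≤ (∑ j, (C j).size) * 2 ^ n ∧
        ∀ x, x ∉ E → ∀ j, P j x = bit p ((C j).eval x) := by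
  classical
  have hp := (Fact.out : p.Prime)
  have hM1 : 1 ≤ (p - 1) * ℓ := Nat.mul_pos (by have := hp.two_le; omega) hℓ
  have hone : ∀ j, ∃ (P : CubeFn (ZMod p) n) (E : Finset (Fin n → Bool)),
      P ∈ lowDeg (ZMod p) n (((p - 1) * ℓ) ^ d) ∧ E.card * p ^ ℓ ≤ (C j).size * 2 ^ n ∧
        ∀ x, x ∉ E → P x = bit p ((C j).eval x) := fun j => by
    obtain ⟨P, E, hP, hE, hPE⟩ := razborov_smolensky (C j) (hC j) hℓ
    exact ⟨P, E, lowDeg_mono (Nat.pow_le_pow_right hM1 (hd j)) hP, hE, hPE⟩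
  choose P E hP hE hPE using hone
  refine ⟨P, univ.biUnion E, hP, ?_, fun x hx j =>
    hPE j x fun h => hx (Finset.mem_biUnion.2 ⟨j, Finset.mem_univ _, h⟩)⟩
  calc (univ.biUnion E).card * p ^ ℓ ≤ (∑ j, (E j).card) * p ^ ℓ :=
        Nat.mul_le_mul_right _ Finset.card_biUnion_le
    _ = ∑ j, (E j).card * p ^ ℓ := Finset.sum_mul _ _ _
    _ ≤ ∑ j, (C j).size * 2 ^ n := Finset.sum_le_sum fun j _ => hE j
    _ = (∑ j, (C j).size) * 2 ^ n := (Finset.sum_mul _ _ _).symm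

/-- **Post-processing the output wires keeps the degree low.** In the situation of
`razborov_smolensky_multi`, for any field `F` receiving `𝔽_p` and ANY function
`Φ : {0,1}^m → F` of the `m` output bits, the function `x ↦ Φ(C_1(x), …, C_m(x))` agrees outside
an exceptional set `E` with `|E|·p^ℓ ≤ (Σ_j size C_j)·2ⁿ` with a polynomial function of degree
`≤ m·((p-1)ℓ)^d`, namely the multilinear extension
`Σ_v Φ(v) Π_j (P_j if v_j = 1, 1 - P_j if v_j = 0)` of `Φ` evaluated at the approximants
(Smolensky 1987, Lemma 1: composing with a gate of fan-in `m` multiplies degrees by at most `m`).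
[cite: Smolensky1987, Lemmas 1–2] -/
theorem razborov_smolensky_postprocess {m : ℕ} (C : Fin m → Circuit (Fin n))
    (hC : ∀ j, (C j).IsOver (accBasis p)) {d : ℕ} (hd : ∀ j, (C j).acDepth ≤ d) {ℓ : ℕ}
    (hℓ : 1 ≤ ℓ) (φ : ZMod p →+* F) (Φ : (Fin m → Bool) → F) :
    ∃ (Q : CubeFn F n) (E : Finset (Fin n → Bool)),
      Q ∈ lowDeg F n (m * ((p - 1) * ℓ) ^ d) ∧ E.card * p ^ ℓ ≤ (∑ j, (C j).size) * 2 ^ n ∧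
        ∀ x, x ∉ E → Q x = Φ (fun j => (C j).eval x) := by
  classical
  obtain ⟨P, E, hP, hE, hPE⟩ := razborov_smolensky_multi C hC hd hℓ
  -- the base-changed approximants `Pφ j = φ ∘ P j` and their literals `R j b`
  obtain ⟨Pφ, hPφdef⟩ : ∃ Pφ : Fin m → CubeFn F n, ∀ j x, Pφ j x = φ (P j x) :=
    ⟨fun j x => φ (P j x), fun _ _ => rfl⟩
  have hPφ : ∀ j, Pφ j ∈ lowDeg F n (((p - 1) * ℓ) ^ d) := fun j => by
    have h : Pφ j = fun x => φ (P j x) := funext (hPφdef j)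
    rw [h]
    exact comp_mem_lowDeg φ (hP j)
  obtain ⟨R, hRdef⟩ : ∃ R : Fin m → Bool → CubeFn F n,
      ∀ j b, R j b = if b then Pφ j else 1 - Pφ j := ⟨_, fun _ _ => rfl⟩
  have hR : ∀ j b, R j b ∈ lowDeg F n (((p - 1) * ℓ) ^ d) := fun j b => by
    rw [hRdef]
    cases b
    · exact Submodule.sub_mem _ (one_mem_lowDeg _) (hPφ j)
    · exact hPφ j
  have hRx : ∀ j b x, x ∉ E → R j b x = if (C j).eval x = b then 1 else 0 := by
    intro j b x hx
    have h : Pφ j x = if (C j).eval x then 1 else 0 := by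
      rw [hPφdef, hPE x hx j]
      cases (C j).eval x
      · rw [bit_false, map_zero]; rfl
      · rw [bit_true, map_one]; rfl
    rw [hRdef]
    cases b <;> cases hc : (C j).eval x <;> simp [h, hc]
  -- the multilinear extension of `Φ` at the approximants
  obtain ⟨Q, hQdef⟩ : ∃ Q : CubeFn F n, Q = ∑ v : Fin m → Bool, Φ v • ∏ j, R j (v j) :=
    ⟨_, rfl⟩
  refine ⟨Q, E, ?_, hE, fun x hx => ?_⟩
  · rw [hQdef]
    refine Submodule.sum_mem _ fun v _ => Submodule.smul_mem _ _ ?_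
    have h := prod_mem_lowDeg (univ : Finset (Fin m)) (fun j _ => hR j (v j))
    rwa [Finset.card_univ, Fintype.card_fin] at h
  · rw [hQdef]
    simp only [Finset.sum_apply, Pi.smul_apply, Finset.prod_apply, smul_eq_mul]
    have hprod : ∀ v : Fin m → Bool,
        (∏ j, R j (v j) x) = if (fun j => (C j).eval x) = v then 1 else 0 := by
      intro v
      by_cases hv : (fun j => (C j).eval x) = v
      · rw [if_pos hv]
        refine Finset.prod_eq_one fun j _ => ?_
        rw [hRx j (v j) x hx, if_pos (congrFun hv j)]
      · rw [if_neg hv]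
        have hj : ∃ j, (C j).eval x ≠ v j := by
          by_contra hall
          push Not at hall
          exact hv (funext hall)
        obtain ⟨j, hj⟩ := hj
        exact Finset.prod_eq_zero (Finset.mem_univ j) (by rw [hRx j (v j) x hx, if_neg hj])
    rw [Finset.sum_congr rfl fun v _ => by rw [hprod v]]
    simp only [mul_ite, mul_one, mul_zero]
    rw [Finset.sum_ite_eq]
    exact if_pos (Finset.mem_univ _)

/-! ### Circuit level: the correlation bounds -/

/-- **Smolensky's correlation bound for PARITY against `AC⁰[p]`, `p` odd** (Grewal–Kumar 2024,
Thm. 4.2 with `k = 1`, i.e. `AC⁰[p]`; Watts–Kothari–Schaeffer–Tal 2019, §6; Smolensky 1987):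
for an odd prime `p`, `n` odd, a circuit `C` over `accBasis p = {¬, ∧ₖ, ∨ₖ, MOD_{p,k}}` of
`acDepth ≤ d`, and every `ℓ ≥ 1`, the set `A = {x | C(x) = PARITY(x)}` satisfies
`|A|·p^ℓ ≤ (2ⁿ⁻¹ + ((p-1)ℓ)^d·C(n, n/2))·p^ℓ + size(C)·2ⁿ`, i.e.
`Pr_x[C(x) = PARITY(x)] ≤ 1/2 + ((p-1)ℓ)^d·C(n,n/2)/2ⁿ + size(C)/p^ℓ`
(approximate `C` by `P` of degree `((p-1)ℓ)^d` off `E`, `|E|·p^ℓ ≤ size·2ⁿ`; on `A \ E`, `P`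
agrees with `[PARITY]`, so `|A| ≤ |{P = [PARITY]}| + |E|` and `parity_agreement_le` applies).
[cite: GrewalKumar2024, Thm. 4.2] -/
theorem parity_correlation_bound (hp2 : p ≠ 2) (hn : Odd n) {d : ℕ} (C : Circuit (Fin n))
    (hC : C.IsOver (accBasis p)) (hd : C.acDepth ≤ d) {ℓ : ℕ} (hℓ : 1 ≤ ℓ) :
    (univ.filter fun x => C.eval x = parityFn n x).card * p ^ ℓ ≤
      (2 ^ (n - 1) + ((p - 1) * ℓ) ^ d * n.choose (n / 2)) * p ^ ℓ + C.size * 2 ^ n := by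
  classical
  have hp := (Fact.out : p.Prime)
  have h2F : (2 : ZMod p) ≠ 0 := by
    intro h
    have h' : ((2 : ℕ) : ZMod p) = 0 := by exact_mod_cast h
    rw [ZMod.natCast_eq_zero_iff] at h'
    exact hp2 ((Nat.prime_dvd_prime_iff_eq hp Nat.prime_two).1 h')
  have hM1 : 1 ≤ (p - 1) * ℓ := Nat.mul_pos (by have := hp.two_le; omega) hℓ
  obtain ⟨P, E, hP, hE, hPE⟩ := razborov_smolensky C hC hℓ
  have hagree : (univ.filter fun x => P x = if parityFn n x then 1 else 0).card ≤
      2 ^ (n - 1) + ((p - 1) * ℓ) ^ d * n.choose (n / 2) := by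
    convert parity_agreement_le hn h2F (lowDeg_mono (Nat.pow_le_pow_right hM1 hd) hP)
  have hsub : (univ.filter fun x => C.eval x = parityFn n x) ⊆
      (univ.filter fun x => P x = if parityFn n x then 1 else 0) ∪ E := by
    intro x hx
    simp only [Finset.mem_filter, Finset.mem_univ, true_and] at hx
    rw [Finset.mem_union, Finset.mem_filter]
    by_cases hxE : x ∈ E
    · exact Or.inr hxE
    · refine Or.inl ⟨Finset.mem_univ _, ?_⟩
      rw [hPE x hxE, hx]
      rfl
  have hcard := (Finset.card_le_card hsub).trans (Finset.card_union_le _ _)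
  calc (univ.filter fun x => C.eval x = parityFn n x).card * p ^ ℓ
      ≤ ((univ.filter fun x => P x = if parityFn n x then 1 else 0).card + E.card) * p ^ ℓ :=
        Nat.mul_le_mul_right _ hcard
    _ = (univ.filter fun x => P x = if parityFn n x then 1 else 0).card * p ^ ℓ +
          E.card * p ^ ℓ := add_mul _ _ _
    _ ≤ (2 ^ (n - 1) + ((p - 1) * ℓ) ^ d * n.choose (n / 2)) * p ^ ℓ + C.size * 2 ^ n :=
        Nat.add_le_add (Nat.mul_le_mul_right _ hagree) hE

/-- **Correlation bound for MAJORITY against `AC⁰[p]`, every prime `p`** (Razborov 1987 for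
`p = 2`; Smolensky 1987; Grewal–Kumar 2024, Thm. 4.2 with `k = 1`): for `n` odd, a circuit `C`
over `accBasis p` of `acDepth ≤ d`, and every `ℓ ≥ 1`, the set `A = {x | C(x) = MAJ(x)}` satisfies
`|A|·p^ℓ ≤ (2ⁿ⁻¹ + ((p-1)ℓ)^d·C(n, n/2))·p^ℓ + size(C)·2ⁿ`. [cite: GrewalKumar2024, Thm. 4.2] -/
theorem majority_correlation_bound (hn : Odd n) {d : ℕ} (C : Circuit (Fin n))
    (hC : C.IsOver (accBasis p)) (hd : C.acDepth ≤ d) {ℓ : ℕ} (hℓ : 1 ≤ ℓ) :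
    (univ.filter fun x => C.eval x = majorityFn n x).card * p ^ ℓ ≤
      (2 ^ (n - 1) + ((p - 1) * ℓ) ^ d * n.choose (n / 2)) * p ^ ℓ + C.size * 2 ^ n := by
  classical
  have hp := (Fact.out : p.Prime)
  have hM1 : 1 ≤ (p - 1) * ℓ := Nat.mul_pos (by have := hp.two_le; omega) hℓ
  obtain ⟨P, E, hP, hE, hPE⟩ := razborov_smolensky C hC hℓ
  have hagree : (univ.filter fun x => P x = if majorityFn n x then 1 else 0).card ≤
      2 ^ (n - 1) + ((p - 1) * ℓ) ^ d * n.choose (n / 2) := by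
    convert majority_agreement_le hn (lowDeg_mono (Nat.pow_le_pow_right hM1 hd) hP)
  have hsub : (univ.filter fun x => C.eval x = majorityFn n x) ⊆
      (univ.filter fun x => P x = if majorityFn n x then 1 else 0) ∪ E := by
    intro x hx
    simp only [Finset.mem_filter, Finset.mem_univ, true_and] at hx
    rw [Finset.mem_union, Finset.mem_filter]
    by_cases hxE : x ∈ E
    · exact Or.inr hxE
    · refine Or.inl ⟨Finset.mem_univ _, ?_⟩
      rw [hPE x hxE, hx]
      rfl
  have hcard := (Finset.card_le_card hsub).trans (Finset.card_union_le _ _)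
  calc (univ.filter fun x => C.eval x = majorityFn n x).card * p ^ ℓ
      ≤ ((univ.filter fun x => P x = if majorityFn n x then 1 else 0).card + E.card) * p ^ ℓ :=
        Nat.mul_le_mul_right _ hcard
    _ = (univ.filter fun x => P x = if majorityFn n x then 1 else 0).card * p ^ ℓ +
          E.card * p ^ ℓ := add_mul _ _ _
    _ ≤ (2 ^ (n - 1) + ((p - 1) * ℓ) ^ d * n.choose (n / 2)) * p ^ ℓ + C.size * 2 ^ n :=
        Nat.add_le_add (Nat.mul_le_mul_right _ hagree) hE

/-- **Correlation bound for `Σ xᵢ mod q` against `AC⁰[p]`, `q ≠ p` primes, any output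
encoding** (Smolensky 1987, Thm. 2, average-case form; Grewal–Kumar 2024, Prop. 4.1 / Thm. 4.2
and Cor. 5.29 for `q = 3`, `p = 2`): for `n` odd, circuits `C_1, …, C_m` over `accBasis p` of
`acDepth ≤ d` whose output wires are read through an ARBITRARY decoder `dec : {0,1}^m → ℕ` as a
guess for the residue of `Σ xᵢ` modulo `q`, and every `ℓ ≥ 1`, the set
`A = {x | dec(C(x)) ≡ Σ xᵢ (mod q)}` satisfies
`|A|·p^ℓ ≤ (2ⁿ⁻¹ + m·((p-1)ℓ)^d·C(n, n/2))·p^ℓ + (Σ_j size C_j)·2ⁿ` — agreement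
`1/2 + O(m·D/√n) + (Σ size)/p^ℓ`, whatever `q` (post-process with `Φ = ω^{dec}`, `ω` a
nontrivial `q`-th root of unity over `𝔽_p`, then `modq_agreement_le`).
[cite: Smolensky1987, Thm. 2] -/
theorem modq_correlation_bound {q m : ℕ} (hq : q.Prime) (hpq : p ≠ q) (hn : Odd n) {d : ℕ}
    (C : Fin m → Circuit (Fin n)) (hC : ∀ j, (C j).IsOver (accBasis p))
    (hd : ∀ j, (C j).acDepth ≤ d) (dec : (Fin m → Bool) → ℕ) {ℓ : ℕ} (hℓ : 1 ≤ ℓ) :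
    (univ.filter fun x => dec (fun j => (C j).eval x) % q = GateFn.numOnes x % q).card * p ^ ℓ ≤
      (2 ^ (n - 1) + m * ((p - 1) * ℓ) ^ d * n.choose (n / 2)) * p ^ ℓ +
        (∑ j, (C j).size) * 2 ^ n := by
  classical
  obtain ⟨ω, hωq, hω1⟩ := exists_root_of_unity_ne_one (p := p) hq hpq
  obtain ⟨Q, E, hQ, hE, hQx⟩ := razborov_smolensky_postprocess C hC hd hℓ
    (algebraMap (ZMod p) (AlgebraicClosure (ZMod p))) (fun v => ω ^ dec v)
  have hagree := modq_agreement_le hn hq.pos hωq hω1 (fun x => dec fun j => (C j).eval x) hQ E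
    (fun x hx => hQx x hx)
  calc (univ.filter fun x => dec (fun j => (C j).eval x) % q = GateFn.numOnes x % q).card * p ^ ℓ
      ≤ (2 ^ (n - 1) + m * ((p - 1) * ℓ) ^ d * n.choose (n / 2) + E.card) * p ^ ℓ :=
        Nat.mul_le_mul_right _ (by simpa [mul_assoc] using hagree)
    _ = (2 ^ (n - 1) + m * ((p - 1) * ℓ) ^ d * n.choose (n / 2)) * p ^ ℓ + E.card * p ^ ℓ :=
        add_mul _ _ _
    _ ≤ (2 ^ (n - 1) + m * ((p - 1) * ℓ) ^ d * n.choose (n / 2)) * p ^ ℓ +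
          (∑ j, (C j).size) * 2 ^ n := Nat.add_le_add_left hE _

end Smolensky

end Literature.Computability.MetaComplexity
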